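import Literature.MathematicalPhysics.QuantumFieldTheory.Balaban1983to89.B15AveragingHolomorphicLocal
import Literature.MathematicalPhysics.QuantumFieldTheory.Balaban1983to89.B15AveragingAnalytic

/-!
# `Balaban1983to89.B15AveragingHolomorphicLocalAnalytic` — [Balaban1987RG1] = «[I]», (0.4) p. 253, (0.21) p. 256; [Balaban1985Variational] = «[15]», Sect. G p. 307, Prop. 9 (190) p. 309:
# ON A SATURATED REGION THE HOLOMORPHIC ITERATE AT A BOND IS ANALYTIC UNDER THE POLYDISC CONDITION ALONG THAT TOWER ONLY; THE TOWER CONDITION IS OPEN, GIVES THE TOWER GUARD OF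
# NEARBY `SU(N)` FIELDS, AND CARRIES `θ(A) = (A⋆)⁻¹` THROUGH THE ITERATE

Honest framing: statement-level skeleton of published theorems with citation tags; proofs where landed; nothing here is a claim about the
Yang–Mills mass gap.  Cell `pub-ymgap`, HUMAN RULING D-0062 (Track A), seat `pub-ymgap-dag-n12-c` g24 (lane owner N12 = [B15], strategy s1; lane memo
`N12-UNIFORMITY-SPEC.md` §6 «LOCATED-E1-HSB», the analytic layer of repair step (r3)); count-neutral; N12 NOT discharged; finite 𝕋⁴ at fixed ε; nothing continuum ∕ OS ∕ mass-gap ∕ Clay.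

WHY.  The w1 lineage's `B15Prop1DatumCoordinates` (the logarithmic datum coordinates `κ Q i = logCoordC (W_j(c)⋆ · iterMh j Q c)` at the constrained bonds) derives the analyticity, reality,
`θ`-equivariance and injectivity of `κ` near a base datum from FOUR global facts: `B15AveragingAnalytic.analyticAt_iterMh_of_polydisc` (analyticity of the WHOLE level-`j` iterate under the
polydisc condition at EVERY coarse bond), its openness `eventually_norm_loopMh_iterMh_lt`, `smallBelow_of_norm_loopMh_lt` ∕ `eventually_smallBelow` (the global guard from the global matrix
inequalities) and `B15AveragingHolomorphic.iterMh_theta` (global `1∕3`-polydisc).  For data rough off `Z` none is available (lane memo §6).  But `κ` reads `iterMh j Q` AT `c` only, and by step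
(r1) (`B15AveragingHolomorphicLocal`: two-block locality on a saturated region `Y`) every one of the four facts has a TOWER form asking the polydisc condition ∕ the guard on `Y` only.  THIS
MODULE proves the four tower forms; the «TP» twin of `B15Prop1DatumCoordinates` is their assembly.

CONTENTS (theorems only; no `def`, no `instance`, no `sorry`; axioms standard).
§1 `analyticAt_avgMh_apply` (ONE coarse bond) · `loopMh_splice_eq` · ★★ `analyticAt_iterMh_apply_of_polydiscOn` (any complex field; tower polydisc below `k` ⇒ the
   iterate at `c ∈ bondsIn k Y` is analytic) · `continuousAt_loopMh_iterMh_of_polydiscOn`.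
§2 ★ `eventually_polydiscOn` (the tower condition `< δ ≤ 1` is open).
§3 ★ `polydiscOn_of_guardOn` (a tower-guarded `SU(N)` field, or any matrix field matching it on `bondsIn 0 Y`, satisfies the tower inequalities with `δ_N`) · ★ `guardOn_of_polydiscOn`
   (conversely, for `SU(N)` fields) · ★★ `eventually_guardOn` (THE TOWER GUARD IS OPEN among `SU(N)` fields near a tower-guarded one) · `eventually_polydiscOn_one`.
§4 `isUnit_det_iterMh` · `avgMh_theta_apply` (ONE bond) · ★★ `iterMh_theta_apply_of_polydiscOn` (`θ` through the iterate at the bonds of `Y` under the tower `1∕3`-condition).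
HONEST SCOPE: calculus bookkeeping over landed definitions ([folklore]; the (0.4) ∕ Prop. 9 cites are locators); the saturation of `Y` is DISPLAYED; nothing of Bałaban's estimates; N12 NOT
discharged; the YM mass gap (Clay) is NOT proved by any of this — R4 closes only the conditional finite-𝕋⁴ rung `BalabanLadder.UV`.
-/

noncomputable section

namespace Literature.MathematicalPhysics.QuantumFieldTheory.Balaban1983to89.B15AveragingHolomorphicLocalAnalytic

open Set Filter
open scoped Topology
open Literature.MathematicalPhysics.QuantumFieldTheory.Balaban1983to89.Node00
  (SU coeField coeField_apply SmallBelow coe_loopHol norm_loopM_coeField_sub_one_lt)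
open T4Continuum BlockAveraging B15DeterminingSets B15AveragingHolomorphic B15AveragingHolomorphicLocal
open B15AveragingAnalytic (analyticAt_holMh)
open ExpMeanLog (eml expMeanLogSU deltaSU analyticAt_eml)
open B10Eq42TorusConstraint (bondsIn mem_bondsIn_iff)
open B10Eq38TorusDomains (toFine)
open scoped Matrix.Norms.L2Operator

/-! ## §1  Analyticity of the iterate at a bond of a saturated region under the tower polydisc condition -/

section Analytic

variable {P : Params} {N : ℕ}

/-- **ONE COARSE BOND**: `V ↦ avgMh V c` is analytic at `V₀` as soon as the loop matrices AT `c` lie in the polydisc `‖W − 1‖ < 1` (the per-bond form of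
`B15AveragingAnalytic.analyticAt_avgMh`). [cite: Balaban1987RG1, (0.4) p.253 («we assume that it is an analytic function»); Balaban1985Variational, Prop. 9 p.309] -/
theorem analyticAt_avgMh_apply {j : ℕ} {V₀ : PBond P j → Matrix (Fin N) (Fin N) ℂ} (c : PBond P (j + 1)) (h : ∀ i : Idx P, ‖loopMh V₀ c i - 1‖ < 1) :
    AnalyticAt ℂ (fun V : PBond P j → Matrix (Fin N) (Fin N) ℂ => avgMh V c) V₀ := by
  have hin : AnalyticAt ℂ (fun V : PBond P j → Matrix (Fin N) (Fin N) ℂ => fun i : Idx P => loopMh V c i) V₀ :=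
    analyticAt_pi_iff.2 fun i => analyticAt_holMh V₀ _
  have heml : AnalyticAt ℂ (eml : (Idx P → Matrix (Fin N) (Fin N) ℂ) → Matrix (Fin N) (Fin N) ℂ) (fun i => loopMh V₀ c i) :=
    analyticAt_eml (𝔸 := Matrix (Fin N) (Fin N) ℂ) h
  have hcorr : AnalyticAt ℂ (fun V : PBond P j → Matrix (Fin N) (Fin N) ℂ => corrMh V c) V₀ := heml.comp hin
  exact hcorr.mul (analyticAt_holMh V₀ _)

/-- The loop matrices at a bond `c ∈ bondsIn (j+1) Y` of a region saturated at `j` do not see a SPLICE off `bondsIn j Y` (two-block locality, `loopMh_congr₂`).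
[cite: Balaban1987RG1, (0.4) p.253 (bookkeeping)] -/
theorem loopMh_splice_eq {j : ℕ} (hj : j + 1 ≤ P.m + P.K) {Y : Set (Site P 0)} [DecidablePred (· ∈ bondsIn (P := P) j Y)]
    (hY : ∀ s : Site P j, toFine j s ∈ Y ↔ toFine (j + 1) (blockOf s) ∈ Y)
    (W W₀ : PBond P j → Matrix (Fin N) (Fin N) ℂ) {c : PBond P (j + 1)} (hc : c ∈ bondsIn (j + 1) Y) (i : Idx P) :
    loopMh (fun b => if b ∈ bondsIn j Y then W b else W₀ b) c i = loopMh W c i := by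
  rw [mem_bondsIn_iff] at hc
  have hblk : ∀ x : Site P j, (blockOf x = c.src ∨ blockOf x = c.tgt) → toFine j x ∈ Y := by
    intro x hx
    refine (hY x).2 ?_
    rcases hx with h | h
    · rw [h]; exact hc.1
    · rw [h]; exact hc.2
  refine loopMh_congr₂ hj c (fun b h₁ h₂ => ?_) i
  have hb : b ∈ bondsIn j Y := by rw [mem_bondsIn_iff]; exact ⟨hblk _ h₁, hblk _ h₂⟩
  rw [if_pos hb]

/-- ★★ **THE ITERATE AT A BOND OF A SATURATED REGION IS ANALYTIC UNDER THE TOWER POLYDISC CONDITION** — at ANY complex level-`0` field `Q₀` (not only near `SU(N)` fields): if `Y` is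
saturated below `k` and the loop matrices of the iterates `iterMh j Q₀`, `j < k`, lie in the polydisc AT THE BONDS OF `bondsIn (j+1) Y` (nothing asked off `Y`), then for every
`c ∈ bondsIn k Y` the map `V ↦ iterMh k V c` is analytic at `Q₀`.  (Induction: the iterate at `c` factors through the splice freezing the components off `bondsIn k Y` at their values at
`Q₀` — §1 locality —, analytic componentwise by induction; at `Q₀` the splice changes nothing, and one step is §1's `analyticAt_avgMh_apply` from the condition at `c`.)  The tower form of
`B15AveragingAnalytic.analyticAt_iterMh_of_polydisc`. [cite: Balaban1987RG1, (0.4) p.253, (0.21) p.256; Balaban1985Variational, Prop. 9 (190) p.309] -/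
theorem analyticAt_iterMh_apply_of_polydiscOn {Y : Set (Site P 0)} :
    ∀ (k : ℕ), k ≤ P.m + P.K → (∀ j, j < k → ∀ s : Site P j, toFine j s ∈ Y ↔ toFine (j + 1) (blockOf s) ∈ Y) →
      ∀ {Q₀ : PBond P 0 → Matrix (Fin N) (Fin N) ℂ},
        (∀ j, j < k → ∀ c : PBond P (j + 1), c ∈ bondsIn (j + 1) Y → ∀ i : Idx P, ‖loopMh (iterMh j Q₀) c i - 1‖ < 1) →
          ∀ c : PBond P k, c ∈ bondsIn k Y → AnalyticAt ℂ (fun V : PBond P 0 → Matrix (Fin N) (Fin N) ℂ => iterMh k V c) Q₀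
  | 0, _, _, Q₀, _, c, _ => by
    simp only [iterMh_zero]
    exact (ContinuousLinearMap.proj (R := ℂ) (φ := fun _ : PBond P 0 => Matrix (Fin N) (Fin N) ℂ) c).analyticAt Q₀
  | k + 1, hk, hY, Q₀, hpoly, c, hc => by
    classical
    have hk' : k ≤ P.m + P.K := Nat.le_of_succ_le hk
    have hY' : ∀ j, j < k → ∀ s : Site P j, toFine j s ∈ Y ↔ toFine (j + 1) (blockOf s) ∈ Y := fun j hj => hY j (Nat.lt_succ_of_lt hj)
    have hpoly' : ∀ j, j < k → ∀ c : PBond P (j + 1), c ∈ bondsIn (j + 1) Y → ∀ i : Idx P, ‖loopMh (iterMh j Q₀) c i - 1‖ < 1 :=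
      fun j hj => hpoly j (Nat.lt_succ_of_lt hj)
    -- (a) the iterate at `c` factors through the splice freezing the components off `bondsIn k Y` at `Q₀`'s values, for EVERY `V`
    have hfac : (fun V : PBond P 0 → Matrix (Fin N) (Fin N) ℂ => iterMh (k + 1) V c) =
        fun V => avgMh (fun b => if b ∈ bondsIn k Y then iterMh k V b else iterMh k Q₀ b) c := by
      funext V
      rw [iterMh_succ]
      exact avgMh_apply_congr_of_eqOn_bondsIn hk (hY k (Nat.lt_succ_self k)) (fun b hb => by rw [if_pos hb]) hc
    rw [hfac]
    -- (b) the splice of the iterate is analytic at `Q₀`: components on `Y` by induction, the others constant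
    have hsplA : AnalyticAt ℂ (fun V : PBond P 0 → Matrix (Fin N) (Fin N) ℂ => fun b : PBond P k =>
        if b ∈ bondsIn k Y then iterMh k V b else iterMh k Q₀ b) Q₀ := by
      refine analyticAt_pi_iff.2 fun b => ?_
      by_cases hb : b ∈ bondsIn k Y
      · simp only [if_pos hb]
        exact analyticAt_iterMh_apply_of_polydiscOn k hk' hY' hpoly' b hb
      · simp only [if_neg hb]
        exact analyticAt_const
    -- (c) at `Q₀` the splice changes nothing
    have hid : (fun b : PBond P k => if b ∈ bondsIn k Y then iterMh k Q₀ b else iterMh k Q₀ b) = iterMh k Q₀ := by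
      funext b
      split_ifs <;> rfl
    -- (d) one step at `iterMh k Q₀` from the condition at `c`
    have havg : AnalyticAt ℂ (fun W : PBond P k → Matrix (Fin N) (Fin N) ℂ => avgMh W c)
        ((fun V : PBond P 0 → Matrix (Fin N) (Fin N) ℂ => fun b : PBond P k => if b ∈ bondsIn k Y then iterMh k V b else iterMh k Q₀ b) Q₀) := by
      show AnalyticAt ℂ (fun W : PBond P k → Matrix (Fin N) (Fin N) ℂ => avgMh W c)
        (fun b : PBond P k => if b ∈ bondsIn k Y then iterMh k Q₀ b else iterMh k Q₀ b)
      rw [hid]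
      exact analyticAt_avgMh_apply c (hpoly k (Nat.lt_succ_self k) c hc)
    exact AnalyticAt.comp (g := fun W : PBond P k → Matrix (Fin N) (Fin N) ℂ => avgMh W c)
      (f := fun V : PBond P 0 → Matrix (Fin N) (Fin N) ℂ => fun b : PBond P k => if b ∈ bondsIn k Y then iterMh k V b else iterMh k Q₀ b)
      (x := Q₀) havg hsplA

/-- For `c ∈ bondsIn (k+1) Y` (`Y` saturated below `k+1`), under the tower polydisc condition below `k` every loop matrix `Q ↦ loopMh (iterMh k Q) c i` is CONTINUOUS at `Q₀` (it reads
the iterate on `bondsIn k Y` only, where it is analytic). [cite: Balaban1987RG1, (0.4) p.253 (bookkeeping)] -/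
theorem continuousAt_loopMh_iterMh_of_polydiscOn {Y : Set (Site P 0)} {k : ℕ} (hk : k + 1 ≤ P.m + P.K)
    (hY : ∀ j, j < k + 1 → ∀ s : Site P j, toFine j s ∈ Y ↔ toFine (j + 1) (blockOf s) ∈ Y)
    {Q₀ : PBond P 0 → Matrix (Fin N) (Fin N) ℂ}
    (hpoly : ∀ j, j < k → ∀ c : PBond P (j + 1), c ∈ bondsIn (j + 1) Y → ∀ i : Idx P, ‖loopMh (iterMh j Q₀) c i - 1‖ < 1)
    {c : PBond P (k + 1)} (hc : c ∈ bondsIn (k + 1) Y) (i : Idx P) :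
    ContinuousAt (fun Q : PBond P 0 → Matrix (Fin N) (Fin N) ℂ => loopMh (iterMh k Q) c i) Q₀ := by
  classical
  have hk' : k ≤ P.m + P.K := Nat.le_of_succ_le hk
  have hY' : ∀ j, j < k → ∀ s : Site P j, toFine j s ∈ Y ↔ toFine (j + 1) (blockOf s) ∈ Y := fun j hj => hY j (Nat.lt_succ_of_lt hj)
  have hfac : (fun Q : PBond P 0 → Matrix (Fin N) (Fin N) ℂ => loopMh (iterMh k Q) c i) =
      fun Q => loopMh (fun b => if b ∈ bondsIn k Y then iterMh k Q b else iterMh k Q₀ b) c i := by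
    funext Q
    rw [loopMh_splice_eq hk (hY k (Nat.lt_succ_self k)) (iterMh k Q) (iterMh k Q₀) hc i]
  rw [hfac]
  have hsplA : AnalyticAt ℂ (fun Q : PBond P 0 → Matrix (Fin N) (Fin N) ℂ => fun b : PBond P k =>
      if b ∈ bondsIn k Y then iterMh k Q b else iterMh k Q₀ b) Q₀ := by
    refine analyticAt_pi_iff.2 fun b => ?_
    by_cases hb : b ∈ bondsIn k Y
    · simp only [if_pos hb]
      exact analyticAt_iterMh_apply_of_polydiscOn k hk' hY' hpoly b hb
    · simp only [if_neg hb]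
      exact analyticAt_const
  exact (AnalyticAt.comp (g := fun W : PBond P k → Matrix (Fin N) (Fin N) ℂ => loopMh W c i)
    (f := fun Q : PBond P 0 → Matrix (Fin N) (Fin N) ℂ => fun b : PBond P k => if b ∈ bondsIn k Y then iterMh k Q b else iterMh k Q₀ b)
    (x := Q₀) (analyticAt_holMh _ _) hsplA).continuousAt

end Analytic

/-! ## §2  The tower polydisc condition is open -/

section Open

variable {P : Params} {N : ℕ}

/-- ★ **THE TOWER POLYDISC CONDITION IS OPEN**: strict bounds `< δ ≤ 1` on the loop matrices of the iterates below `k` at the bonds of `Y` persist near `Q₀` (finitely many strict inequalities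
on functions continuous at `Q₀` by §1; induction-free: level `j` uses the condition below `j`).  The tower form of `B15Prop1DatumCoordinates.eventually_norm_loopMh_iterMh_lt`.
[cite: Balaban1987RG1, (0.4) p.253 (bookkeeping)] -/
theorem eventually_polydiscOn {Y : Set (Site P 0)} (k : ℕ) (hk : k ≤ P.m + P.K)
    (hY : ∀ j, j < k → ∀ s : Site P j, toFine j s ∈ Y ↔ toFine (j + 1) (blockOf s) ∈ Y)
    {Q₀ : PBond P 0 → Matrix (Fin N) (Fin N) ℂ} {δ : ℝ} (hδ : δ ≤ 1)
    (h : ∀ j, j < k → ∀ c : PBond P (j + 1), c ∈ bondsIn (j + 1) Y → ∀ i : Idx P, ‖loopMh (iterMh j Q₀) c i - 1‖ < δ) :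
    ∀ᶠ Q in 𝓝 Q₀, ∀ j, j < k → ∀ c : PBond P (j + 1), c ∈ bondsIn (j + 1) Y → ∀ i : Idx P, ‖loopMh (iterMh j Q) c i - 1‖ < δ := by
  have key : ∀ j, j < k → ∀ (c : PBond P (j + 1)) (i : Idx P), ∀ᶠ Q in 𝓝 Q₀, c ∈ bondsIn (j + 1) Y → ‖loopMh (iterMh j Q) c i - 1‖ < δ := by
    intro j hj c i
    by_cases hc : c ∈ bondsIn (j + 1) Y
    · have hcont : ContinuousAt (fun Q : PBond P 0 → Matrix (Fin N) (Fin N) ℂ => ‖loopMh (iterMh j Q) c i - 1‖) Q₀ :=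
        ((continuousAt_loopMh_iterMh_of_polydiscOn (by omega) (fun j' hj' => hY j' (by omega))
          (fun j' hj' c' hc' i' => lt_of_lt_of_le (h j' (hj'.trans hj) c' hc' i') hδ) hc i).sub continuousAt_const).norm
      filter_upwards [hcont.eventually (Iio_mem_nhds (h j hj c hc i))] with Q hQ _ using hQ
    · exact Eventually.of_forall fun Q h' => absurd h' hc
  have hfin : ∀ᶠ Q in 𝓝 Q₀, ∀ j : Fin k, ∀ (c : PBond P (j + 1)) (i : Idx P), c ∈ bondsIn (j + 1) Y → ‖loopMh (iterMh j Q) c i - 1‖ < δ :=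
    eventually_all.2 fun j => eventually_all.2 fun c => eventually_all.2 fun i => key j j.2 c i
  filter_upwards [hfin] with Q hQ j hj c hc i using hQ ⟨j, hj⟩ c i hc

end Open

/-! ## §3  `SU(N)` fields: the tower guard ⟺ the tower matrix inequalities; the tower guard is open -/

section Guard

variable {P : Params} {N : ℕ} [NeZero N]

/-- ★ **A TOWER-GUARDED `SU(N)` FIELD — OR ANY MATRIX FIELD MATCHING IT ON `bondsIn 0 Y` — SATISFIES THE TOWER MATRIX INEQUALITIES WITH `δ_N`**: for `Y` saturated below `k`, `U` guarded on
`Y` below `k` and `V₀ = ↑U` on `bondsIn 0 Y`, every loop matrix of `iterMh j V₀`, `j < k`, at a bond of `bondsIn (j+1) Y` is within `δ_N` of `1` (the iterate there is the matrix of `Ū^j U` —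
step (r1)'s `iterMh_coeField_apply_eq_of_guardOn` — whose loop variables the guard controls).  The tower form of `B15Prop1DatumCoordinates.norm_loopMh_iterMh_lt_of_smallBelow`.
[cite: Balaban1987RG1, (0.4) p.253, (0.21) p.256] -/
theorem polydiscOn_of_guardOn {Y : Set (Site P 0)} (k : ℕ) (hk : k ≤ P.m + P.K)
    (hY : ∀ j, j < k → ∀ s : Site P j, toFine j s ∈ Y ↔ toFine (j + 1) (blockOf s) ∈ Y)
    {U : GaugeField P 0 (SU N)}
    (hg : ∀ j, j < k → ∀ c : PBond P (j + 1), c ∈ bondsIn (j + 1) Y → Small expMeanLogSU (Averaging.iter (fun j => blockAvg (P := P) (j := j) expMeanLogSU) j U) c)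
    {V₀ : PBond P 0 → Matrix (Fin N) (Fin N) ℂ} (hV₀ : ∀ b : PBond P 0, b ∈ bondsIn 0 Y → V₀ b = coeField U b) :
    ∀ j, j < k → ∀ c : PBond P (j + 1), c ∈ bondsIn (j + 1) Y → ∀ i : Idx P, ‖loopMh (iterMh j V₀) c i - 1‖ < deltaSU (Fin N) := by
  intro j hj c hc i
  have hjK : j + 1 ≤ P.m + P.K := by omega
  have hY' : ∀ j', j' < j → ∀ s : Site P j', toFine j' s ∈ Y ↔ toFine (j' + 1) (blockOf s) ∈ Y := fun j' hj' => hY j' (hj'.trans hj)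
  have hg' : ∀ j', j' < j → ∀ c' : PBond P (j' + 1), c' ∈ bondsIn (j' + 1) Y →
      Small expMeanLogSU (Averaging.iter (fun j => blockAvg (P := P) (j := j) expMeanLogSU) j' U) c' := fun j' hj' => hg j' (hj'.trans hj)
  -- on `bondsIn j Y` the iterate of `V₀` is the matrix of `Ū^j U`
  have heq : ∀ b : PBond P j, b ∈ bondsIn j Y →
      iterMh j V₀ b = coeField (Averaging.iter (fun j => blockAvg (P := P) (j := j) expMeanLogSU) j U) b := fun b hb => by
    rw [iterMh_apply_congr_of_eqOn_bondsIn j (by omega) hY' hV₀ b hb]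
    exact iterMh_coeField_apply_eq_of_guardOn j (by omega) hY' hg' b hb
  -- the loop matrices at `c` read `bondsIn j Y` only
  rw [mem_bondsIn_iff] at hc
  have hblk : ∀ x : Site P j, (blockOf x = c.src ∨ blockOf x = c.tgt) → toFine j x ∈ Y := by
    intro x hx
    refine (hY j hj x).2 ?_
    rcases hx with h' | h'
    · rw [h']; exact hc.1
    · rw [h']; exact hc.2
  have hc' : c ∈ bondsIn (j + 1) Y := mem_bondsIn_iff.2 hc
  rw [loopMh_congr₂ hjK c (fun b h₁ h₂ => heq b (mem_bondsIn_iff.2 ⟨hblk _ h₁, hblk _ h₂⟩)) i, loopMh_coeField]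
  exact norm_loopM_coeField_sub_one_lt _ c (hg j hj c hc') i

/-- ★ **CONVERSELY: THE TOWER MATRIX INEQUALITIES WITH `δ_N` GIVE THE TOWER GUARD** of an `SU(N)` field (induction on the level: under the guard so far, the holomorphic iterate on `Y` IS the
averaging of record there).  The tower form of `B15Prop1DatumCoordinates.smallBelow_of_norm_loopMh_lt`. [cite: Balaban1987RG1, (0.4) p.253, (0.21) p.256] -/
theorem guardOn_of_polydiscOn {Y : Set (Site P 0)} {U : GaugeField P 0 (SU N)} :
    ∀ (k : ℕ), k ≤ P.m + P.K → (∀ j, j < k → ∀ s : Site P j, toFine j s ∈ Y ↔ toFine (j + 1) (blockOf s) ∈ Y) →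
      (∀ j, j < k → ∀ c : PBond P (j + 1), c ∈ bondsIn (j + 1) Y → ∀ i : Idx P, ‖loopMh (iterMh j (coeField U)) c i - 1‖ < deltaSU (Fin N)) →
        ∀ j, j < k → ∀ c : PBond P (j + 1), c ∈ bondsIn (j + 1) Y → Small expMeanLogSU (Averaging.iter (fun j => blockAvg (P := P) (j := j) expMeanLogSU) j U) c
  | 0, _, _, _ => fun j hj => absurd hj (Nat.not_lt_zero j)
  | k + 1, hk, hY, h => by
    have hk' : k ≤ P.m + P.K := Nat.le_of_succ_le hk
    have hY' : ∀ j, j < k → ∀ s : Site P j, toFine j s ∈ Y ↔ toFine (j + 1) (blockOf s) ∈ Y := fun j hj => hY j (Nat.lt_succ_of_lt hj)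
    have ih := guardOn_of_polydiscOn k hk' hY' fun j hj => h j (Nat.lt_succ_of_lt hj)
    intro j hj c hc
    rcases Nat.lt_succ_iff_lt_or_eq.1 hj with hjk | rfl
    · exact ih j hjk c hc
    · -- level `k`: the iterate of `↑U` on `bondsIn k Y` is `↑(Ū^k U)` by the guard below `k`
      have heq : ∀ b : PBond P j, b ∈ bondsIn j Y →
          iterMh j (coeField U) b = coeField (Averaging.iter (fun j => blockAvg (P := P) (j := j) expMeanLogSU) j U) b :=
        fun b hb => iterMh_coeField_apply_eq_of_guardOn j hk' hY' ih b hb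
      have hm := h j hj c hc
      rw [mem_bondsIn_iff] at hc
      have hblk : ∀ x : Site P j, (blockOf x = c.src ∨ blockOf x = c.tgt) → toFine j x ∈ Y := by
        intro x hx
        refine (hY j hj x).2 ?_
        rcases hx with h' | h'
        · rw [h']; exact hc.1
        · rw [h']; exact hc.2
      intro i
      have hmi := hm i
      rw [loopMh_congr₂ hk c (fun b h₁ h₂ => heq b (mem_bondsIn_iff.2 ⟨hblk _ h₁, hblk _ h₂⟩)) i, loopMh_coeField, ← coe_loopHol] at hmi
      exact hmi

/-- ★★ **THE TOWER GUARD IS OPEN**: near the matrix field of an `SU(N)` configuration guarded ON `Y` below `k` (`Y` saturated below `k`), every `SU(N)` configuration is guarded on `Y`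
below `k` — nothing asked or concluded off `Y`.  The tower form of `B15Prop1DatumCoordinates.eventually_smallBelow`. [cite: Balaban1987RG1, (0.4) p.253, (0.21) p.256] -/
theorem eventually_guardOn {Y : Set (Site P 0)} (k : ℕ) (hk : k ≤ P.m + P.K)
    (hY : ∀ j, j < k → ∀ s : Site P j, toFine j s ∈ Y ↔ toFine (j + 1) (blockOf s) ∈ Y)
    {U₀ : GaugeField P 0 (SU N)}
    (hg : ∀ j, j < k → ∀ c : PBond P (j + 1), c ∈ bondsIn (j + 1) Y → Small expMeanLogSU (Averaging.iter (fun j => blockAvg (P := P) (j := j) expMeanLogSU) j U₀) c) :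
    ∀ᶠ Q in 𝓝 (coeField U₀), ∀ U : GaugeField P 0 (SU N), coeField U = Q →
      ∀ j, j < k → ∀ c : PBond P (j + 1), c ∈ bondsIn (j + 1) Y → Small expMeanLogSU (Averaging.iter (fun j => blockAvg (P := P) (j := j) expMeanLogSU) j U) c := by
  have hδ : deltaSU (Fin N) ≤ 1 := by unfold deltaSU; exact (min_le_left _ _).trans (by norm_num)
  filter_upwards [eventually_polydiscOn k hk hY hδ (polydiscOn_of_guardOn k hk hY hg fun _ _ => rfl)] with Q hQ U hU
  exact guardOn_of_polydiscOn k hk hY (by rw [hU]; exact hQ)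

/-- The tower polydisc `‖W − 1‖ < 1` for the iterates below `k` on `Y`, near a tower-guarded `SU(N)` field (so §1 applies there). [cite: Balaban1987RG1, (0.4) p.253 (bookkeeping)] -/
theorem eventually_polydiscOn_one {Y : Set (Site P 0)} (k : ℕ) (hk : k ≤ P.m + P.K)
    (hY : ∀ j, j < k → ∀ s : Site P j, toFine j s ∈ Y ↔ toFine (j + 1) (blockOf s) ∈ Y)
    {U₀ : GaugeField P 0 (SU N)}
    (hg : ∀ j, j < k → ∀ c : PBond P (j + 1), c ∈ bondsIn (j + 1) Y → Small expMeanLogSU (Averaging.iter (fun j => blockAvg (P := P) (j := j) expMeanLogSU) j U₀) c) :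
    ∀ᶠ Q in 𝓝 (coeField U₀), ∀ j, j < k → ∀ c : PBond P (j + 1), c ∈ bondsIn (j + 1) Y → ∀ i : Idx P, ‖loopMh (iterMh j Q) c i - 1‖ < 1 :=
  have hδ : deltaSU (Fin N) ≤ 1 := by unfold deltaSU; exact (min_le_left _ _).trans (by norm_num)
  eventually_polydiscOn k hk hY le_rfl fun j hj c hc i =>
    lt_of_lt_of_le (polydiscOn_of_guardOn k hk hY hg (fun _ _ => rfl) j hj c hc i) hδ

end Guard

/-! ## §4  `θ(A) = (A⋆)⁻¹` through the iterate at the bonds of a saturated region -/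

section Theta

variable {P : Params} {N : ℕ}

/-- Invertibility propagates through the holomorphic iterate (`B15AveragingHolomorphic.isUnit_det_avgMh`). [cite: Balaban1987RG1, (0.4) p.253 (bookkeeping)] -/
theorem isUnit_det_iterMh {V : PBond P 0 → Matrix (Fin N) (Fin N) ℂ} (hV : ∀ b, IsUnit (V b).det) :
    ∀ (k : ℕ) (b : PBond P k), IsUnit (iterMh k V b).det
  | 0, b => by rw [iterMh_zero]; exact hV b
  | k + 1, b => by rw [iterMh_succ]; exact isUnit_det_avgMh _ (isUnit_det_iterMh hV k) b

/-- **`θ` THROUGH THE HOLOMORPHIC AVERAGING AT ONE BOND**: at an invertible field whose loop matrices AT `c` lie in the `1∕3`-polydisc, `avgMh (θ ∘ V) c = θ (avgMh V c)` (the per-bond form of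
`B15AveragingHolomorphic.avgMh_theta`). [cite: Balaban1987RG1, (0.4)–(0.5) p.253; Balaban1985Variational, p.307] -/
theorem avgMh_theta_apply {j : ℕ} {V : PBond P j → Matrix (Fin N) (Fin N) ℂ} (hV : ∀ b, IsUnit (V b).det) (c : PBond P (j + 1))
    (h : ∀ i : Idx P, ‖loopMh V c i - 1‖ ≤ 1 / 3) :
    avgMh (fun b => (star (V b))⁻¹) c = (star (avgMh V c))⁻¹ := by
  show eml (fun i : Idx P => loopMh (fun b => (star (V b))⁻¹) c i) * axialMh (fun b => (star (V b))⁻¹) c =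
    (star (eml (fun i : Idx P => loopMh V c i) * axialMh V c))⁻¹
  have hl : (fun i : Idx P => loopMh (fun b => (star (V b))⁻¹) c i) = fun i => (star (loopMh V c i))⁻¹ :=
    funext fun i => holMh_theta V hV _
  rw [hl, eml_star_inv h, show axialMh (fun b => (star (V b))⁻¹) c = (star (axialMh V c))⁻¹ from holMh_theta V hV _, star_inv_mul_star_inv]

/-- ★★ **`θ` THROUGH THE ITERATE AT THE BONDS OF A SATURATED REGION**: at an invertible level-`0` field whose iterates have loop matrices in the `1∕3`-polydisc at the bonds of
`bondsIn (j+1) Y`, `j < k` (`Y` saturated below `k`; nothing asked off `Y`), `iterMh k (θ ∘ V) c = θ (iterMh k V c)` for every `c ∈ bondsIn k Y` (induction: locality of one step on the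
region + `avgMh_theta_apply` at `c`).  The tower form of `B15AveragingHolomorphic.iterMh_theta`. [cite: Balaban1987RG1, (0.21) p.256; Balaban1985Variational, p.307, Prop. 9 p.309] -/
theorem iterMh_theta_apply_of_polydiscOn {Y : Set (Site P 0)} {V : PBond P 0 → Matrix (Fin N) (Fin N) ℂ} (hV : ∀ b, IsUnit (V b).det) :
    ∀ (k : ℕ), k ≤ P.m + P.K → (∀ j, j < k → ∀ s : Site P j, toFine j s ∈ Y ↔ toFine (j + 1) (blockOf s) ∈ Y) →
      (∀ j, j < k → ∀ c : PBond P (j + 1), c ∈ bondsIn (j + 1) Y → ∀ i : Idx P, ‖loopMh (iterMh j V) c i - 1‖ ≤ 1 / 3) →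
        ∀ c : PBond P k, c ∈ bondsIn k Y → iterMh k (fun b => (star (V b))⁻¹) c = (star (iterMh k V c))⁻¹
  | 0, _, _, _, c, _ => by simp only [iterMh_zero]
  | k + 1, hk, hY, h, c, hc => by
    have hk' : k ≤ P.m + P.K := Nat.le_of_succ_le hk
    have ih := iterMh_theta_apply_of_polydiscOn hV k hk' (fun j hj => hY j (Nat.lt_succ_of_lt hj)) fun j hj => h j (Nat.lt_succ_of_lt hj)
    rw [iterMh_succ, iterMh_succ]
    have hloc : avgMh (iterMh k fun b => (star (V b))⁻¹) c = avgMh (fun b => (star (iterMh k V b))⁻¹) c :=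
      avgMh_apply_congr_of_eqOn_bondsIn hk (hY k (Nat.lt_succ_self k)) ih hc
    rw [hloc]
    exact avgMh_theta_apply (isUnit_det_iterMh hV k) c (h k (Nat.lt_succ_self k) c hc)

end Theta

end Literature.MathematicalPhysics.QuantumFieldTheory.Balaban1983to89.B15AveragingHolomorphicLocalAnalytic

end
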